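/- Copyright: the b2b-balaban cell (near-miss cell 7), T⁴-continuum fan-out, ROUND-2 swarm `t4-ne7b-formalise-*`
(leaf 08, gen 2), row NE7b (node U5c COUNT member).  Released under the licence of the surrounding project. -/
import Summits.QuantumFields.BalabanUV.T4Continuum.Support.HistoryRealiseCells
import Summits.QuantumFields.BalabanUV.T4Continuum.Support.HistoryAssemblyRealisePrice

/-!
# Realised histories: the END over realised pending pedigrees WITH DOMAINS (no cell field displayed), and tracking

Summits-side support leaf of the T⁴-continuum cell (rung (B)+1 on a FINITE torus only; NOT infinite volume, NOT the
mass gap, NOT the Clay statement; NOT a proof of the spine estimate NE7b).  Companion of `Support/HistoryRealiseCells.lean`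
(row S1b part 5 ∕ typer cut A12-I.2b-cells of `t4/formal/NE7b/DAG.md` v2.6; journal CLAIM «NE7b-A12-I.2b-cells»).

WHAT.  §1 service lemmas on the display `track` of `HistoryRealiseCells.RealisedDomains`: it is AUTOMATIC at a birth
(`tracks_birth`: the anchor lies in the region) and at a renewal (`tracks_renew`: the new domain is an orbit image), and
at a join it reduces to «the joined domain contains the OLDER partner's current image» (`tracks_join_left` ∕
`tracks_join_right`) — the lower half of the merger sentence of B16 p. 386 («joined together into the one component …
by adding layers»), which `HistoryRealise.Realises` does not record (it records the upper half, (1.84): the joined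
domain lies INSIDE the union of the partners' images); so `track` is displayed, print-faithfully («a first large field
region contained in Z», p. 384).  §2 the END twin **`hybridNE7_of_realisedDomains_canon`** =
`HistoryAssemblyRealiseLE.hybridNE7_of_realisedReading_canon` (leaf-03, p210803) with its binder `H : RealisedReading …`
SUPPLIED by `HistoryRealiseCells.realisedReading_of_domains`: NE7b's COUNT exit (LE currency, shape-free threshold
`irThresholdTLE`) and seam, the live structures read as REALISED PENDING PEDIGREES WITH DOMAINS — the two root-cell
fields `cell_mem` ∕ `cell_inj` are GONE from the display (root cells := `cellOfA`, corner cells at the model scale);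
§3 (v2) its PRINTED-CURRENCY twin **`hybridNE7_of_realisedDomains_printed`** =
`HistoryAssemblyRealisePrice.hybridNE7_of_realisedReading_printed` (leaf-03, p210969) ∘ the same bridge (typer ACCEPT-A12I
v1.3 residue (i)).  [folklore] composition by name; no `def`, no `[cite:]` tag, nothing printed asserted.

HONEST.  The identification of Bałaban's terms with realised pending pedigrees (H3: reading map, `real`, `track`,
`disjoint`, `inBox`), (B) and the BetaPertH-flow facts stay DISPLAYED; NE7b NOT proved; spine 0∕9.  HONEST DEPENDENCY
(cell): continuum YM on T⁴ ⇐ BetaPertH ∧ nine spine estimates (0/9 proved); BetaPertH ⇐ (D1) ∧ (D4) ∧ CAP+tail; G-an2-4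
gates asym, D1 and NE2/3/4.  This file changes none of it. -/

open Finset MeasureTheory
open Literature.MathematicalPhysics.QuantumFieldTheory.Balaban1983to89
open Literature.MathematicalPhysics.QuantumFieldTheory.Balaban1983to89.B13ScaleTransfer
open Literature.MathematicalPhysics.QuantumFieldTheory.Balaban1983to89.B16SProfile
open T4PersistenceDictionary T4PersistentHistoryCount T4BankedInduction T4PrintedShapeBanking
open T4WeightBudget T4GlobalDenominator T4LiveClassFibration T4LiveStructureGas T4LiveGasToTerms T4RecordPriceSeam
open T4PartnerMultiplicity T4IndicatorShell T4MatchingAssembly T4MatchingClosure T4MatchingClosureSocket T4Continuum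
open T4StabilitySocket T4BranchingRecordsGas T4TaggedShapeBanking T4CanonicalMenus T4RenewalChains
open Summit.QuantumFields.BalabanUV.T4Continuum.PlacementBatch
open Summit.QuantumFields.BalabanUV.T4Continuum.PlacementSkeleton
open Summit.QuantumFields.BalabanUV.T4Continuum.CountThresholdUniform
open Summit.QuantumFields.BalabanUV.T4Continuum.CountThresholdExit
open Summit.QuantumFields.BalabanUV.T4Continuum.CountSeamJunction
open Summit.QuantumFields.BalabanUV.T4Continuum.LateMergers
open Summit.QuantumFields.BalabanUV.T4Continuum.HistoryFlow
open Summit.QuantumFields.BalabanUV.T4Continuum.HistoryRegeneration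
open Summit.QuantumFields.BalabanUV.T4Continuum.HistoryTables
open Summit.QuantumFields.BalabanUV.T4Continuum.HistoryAssemblyTrees
open Summit.QuantumFields.BalabanUV.T4Continuum.HistorySocketTH
open Summit.QuantumFields.BalabanUV.T4Continuum.HistoryAssemblyTerms
open Summit.QuantumFields.BalabanUV.T4Continuum.HistoryGen
open Summit.QuantumFields.BalabanUV.T4Continuum.HistoryCaps
open Summit.QuantumFields.BalabanUV.T4Continuum.ZoneTorus
open Summit.QuantumFields.BalabanUV.T4Continuum.HistoryZones
open Summit.QuantumFields.BalabanUV.T4Continuum.HistoryAdmissible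
open Summit.QuantumFields.BalabanUV.T4Continuum.HistoryAssemblyPedigree
open Summit.QuantumFields.BalabanUV.T4Continuum.HistoryBankingLE
open Summit.QuantumFields.BalabanUV.T4Continuum.HistoryTreeShapeLE
open Summit.QuantumFields.BalabanUV.T4Continuum.HistoryExitLE
open Summit.QuantumFields.BalabanUV.T4Continuum.HistoryAssemblyTreesLE
open Summit.QuantumFields.BalabanUV.T4Continuum.HistoryAssemblyTermsLE
open Summit.QuantumFields.BalabanUV.T4Continuum.HistoryAssemblyRealiseLE
open Summit.QuantumFields.BalabanUV.T4Continuum.HistoryConstants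
open Summit.QuantumFields.BalabanUV.T4Continuum.HistoryAssemblyPrice
open Summit.QuantumFields.BalabanUV.T4Continuum.HistoryAssemblyRealisePrice
open Summit.QuantumFields.BalabanUV.T4Continuum.HistoryRealise
open Summit.QuantumFields.BalabanUV.T4Continuum.HistoryRealiseCells

namespace Summit.QuantumFields.BalabanUV.T4Continuum.HistoryRealiseCellsEnd

noncomputable section

variable {d : ℕ}

/-! ## §1 Tracking: the display `track` at births, renewals and joins -/

/-- tracking at a BIRTH is automatic: the anchor lies in the region [folklore] -/
theorem tracks_birth {L : ℕ} {s R : ℕ → ℕ} {j cls : ℕ} {zZ : Pt d × Finset (Pt d)} {Z : Finset (Pt d)}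
    (hP : Realises L s R (.birth j cls zZ) Z) :
    anchorAt L s (.birth j cls zZ) (PGen.birth j cls zZ).lastStep ∈ Z := by
  obtain ⟨hZ, hz, -, -⟩ := hP
  simp only [anchorAt, PGen.lastStep, PGen.rootStep, Nat.sub_self, Qfrom_zero, coarse_one]
  simpa [rootAnchor, PGen.rootCell, hZ] using hz

/-- tracking at a RENEWAL is automatic from the renewed line: the new domain is an orbit image of the old one
[folklore] -/
theorem tracks_renew {L : ℕ} {s : ℕ → ℕ} {G : PGen (Pt d × Finset (Pt d))} {h : ℕ} {ZG Z : Finset (Pt d)}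
    (hG : anchorAt L s G G.lastStep ∈ ZG) (hj : G.rootStep ≤ G.lastStep) (hh : G.lastStep ≤ h + 1)
    (hZ : Z = orbit L s G.lastStep ZG (h + 1 - G.lastStep)) :
    anchorAt L s (.renew G h) (PGen.renew G h).lastStep ∈ Z := by
  have hmem := anchorAt_mem_curDomain L s (K := h + 1) hG hj hh
  subst hZ
  exact hmem

/-- tracking at a JOIN whose OLDER partner is the endpoint `X` reduces to «the joined domain contains the endpoint's
current image» (the lower half of the merger sentence, not recorded by `Realises`) [folklore] -/
theorem tracks_join_left {L : ℕ} {s : ℕ → ℕ} {X Y : PGen (Pt d × Finset (Pt d))} {sj : ℕ} {ZX Z : Finset (Pt d)}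
    (hX : anchorAt L s X X.lastStep ∈ ZX) (hj : X.rootStep ≤ X.lastStep) (ht : X.lastStep ≤ sj)
    (hle : X.rootStep ≤ Y.rootStep) (hlow : curDomain L s X ZX sj ⊆ Z) :
    anchorAt L s (.join X Y sj) (PGen.join X Y sj).lastStep ∈ Z := by
  have hmem := hlow (anchorAt_mem_curDomain L s hX hj ht)
  simpa [anchorAt, PGen.lastStep, PGen.rootStep, rootAnchor, PGen.rootCell, min_eq_left hle, hle] using hmem

/-- … and symmetrically when the older partner is the rest `Y` [folklore] -/
theorem tracks_join_right {L : ℕ} {s : ℕ → ℕ} {X Y : PGen (Pt d × Finset (Pt d))} {sj : ℕ} {ZY Z : Finset (Pt d)}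
    (hY : anchorAt L s Y Y.lastStep ∈ ZY) (hj : Y.rootStep ≤ Y.lastStep) (ht : Y.lastStep ≤ sj)
    (hlt : Y.rootStep < X.rootStep) (hlow : curDomain L s Y ZY sj ⊆ Z) :
    anchorAt L s (.join X Y sj) (PGen.join X Y sj).lastStep ∈ Z := by
  have hmem := hlow (anchorAt_mem_curDomain L s hY hj ht)
  simpa [anchorAt, PGen.lastStep, PGen.rootStep, rootAnchor, PGen.rootCell, min_eq_right hlt.le,
    not_le.2 hlt] using hmem


/-! ## §2 The END: NE7b's COUNT exit (LE) and seam, live structures read as realised pending pedigrees with domains -/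

section End

variable {F : T4Family} {G : Type*} [GaugeGroup G] [MeasurableSpace G] [HaarData G] [RegularGaugeGroup G]
variable {α π : Type*} [DecidableEq α] [DecidableEq π] {sP : ℕ → ℕ}
variable {ι : Type*} [DecidableEq ι] {l₀ vol : ℝ} {K₀ : ℕ} {T : ℕ → Finset ι} {A A' shA shB : ℕ → ℝ → ι → ℝ}
  {dead dead' : ℕ → ℝ → ι → ℝ} {nup mup : ℕ → ℝ → ℝ} {Nup : ℝ}
  {Cc Rr CcRec RrRec : ℕ → ℝ → ι → ℝ} {ν u s₂ q₀ r s Wsh : ℕ → ℝ}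

/-- **NE7b's COUNT EXIT WITH THE LIVE STRUCTURES READ AS REALISED PENDING PEDIGREES WITH DOMAINS — NO CELL FIELD
DISPLAYED** (LE currency, shape-free threshold).  `HistoryAssemblyRealiseLE.hybridNE7_of_realisedReading_canon` (leaf-03)
with its binder `H : RealisedReading …` SUPPLIED by `realisedReading_of_domains` from the displayed `RealisedDomains` of
the reading map `ped`∕`cellP`∕`liveC`∕`Zd` (root cells := `cellOfA`, corner cells at the model scale).  Displayed: the
side conditions `4 ≤ F.L`, drop control of `sP`, `sP` stepwise non-increasing, `0 < n`, `13 ≤ C.n₁`, `1 ≤ R K t`; the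
reading map + `RealisedDomains` (encoding facts `renew_step`∕`forest`∕`headOldest`; geometric facts `real`, `track`,
`disjoint`, `inBox`); per-term prices; `Regeneration` numerator fields; constants + largeness; flow side (⇐ BetaPertH);
tuning; `irThresholdTLE C F.L rr β₀ ≤ log g⁻²`; (2.5); (B); seams. [folklore] -/
theorem hybridNE7_of_realisedDomains_canon (D : FiniteEpsData F G) {C : T4PrintedShapeBanking.Consts}
    {rr : ℕ} {β₀ : ℝ} (h : ThresholdOK C F.L rr β₀) (hμ : 0 < C.μ) (d n : ℕ)
    (hκ₁ : (d : ℝ) * Real.log F.L + 2 * Real.log 2 ≤ C.κ₁) (hE₀ : Real.log (2 + birthMass C) ≤ C.E₀)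
    -- the flow side (⇐ BetaPertH, displayed) and tuning
    {γ₀ γb b β' : ℝ} {pe : ℕ} (hb : 0 ≤ b) (hlo : FlowStep.BetaLowerH b γ₀ D.βfun)
    (hhi : FlowStep.BetaUpperH β' γ₀ D.βfun) (hγ : γb ≤ γ₀) (hγβ : γb ^ 2 * β' < 1)
    (S : B14FlowStep.SmallnessFor γb β' β₀ F.L pe) (hp₀ : C.p₀ ≤ pe) (hrr : rr ≤ pe)
    {g : ℝ} {g₀ : ℕ → ℝ} (ht : D.Tuned γb g g₀)
    (hir : irThresholdTLE C F.L rr β₀ ≤ Real.log (g ^ 2)⁻¹)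
    -- the (B) side
    (hsign : B16.SignConventions D.C) {γB : ℝ} {em ep : ℝ → ℝ} (hcor : B16.Cor3With D.C γB em ep) (hγB : γb ≤ γB)
    {obs : (K : ℕ) → GaugeField (F.P K) 0 G → ℝ} {B : ℝ}
    (hobs : ∀ K, Measurable (obs K)) (hbd : ∀ K U, |obs K U| ≤ B)
    (hα : ∀ K t, |t| ≤ l₀ → K₀ ≤ K →
      ∫ U, Real.exp (t * obs K U) * D.dens K (g₀ K) 0 U ∂fieldMeasure (F.P K) 0 G ≤ ∑ τ ∈ T K, A K t τ)
    (hα' : ∀ K t, |t| ≤ l₀ → K₀ ≤ K →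
      ∫ U, Real.exp (t * obs (K + 1) U) * D.dens (K + 1) (g₀ (K + 1)) 0 U ∂fieldMeasure (F.P (K + 1)) 0 G ≤
        ∑ τ ∈ T K, A' K t τ)
    {c₀ n₁ : ℝ} (hc₀ : 0 < c₀) (hfloor : ∀ K, K₀ ≤ K → c₀ ≤ smallFieldMass D K (g₀ K))
    (hfloor' : ∀ K, K₀ ≤ K → c₀ ≤ smallFieldMass D (K + 1) (g₀ (K + 1)))
    (hsites : ∀ K, K₀ ≤ K → ((D.C ⟨K, F.m, g₀ K⟩).numSites K : ℝ) ≤ n₁)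
    (hsites' : ∀ K, K₀ ≤ K → ((D.C ⟨K + 1, F.m, g₀ (K + 1)⟩).numSites (K + 1) : ℝ) ≤ n₁)
    (hNup : 0 ≤ Nup) (hnup : ∀ K t, |t| ≤ l₀ → K₀ ≤ K → 0 ≤ nup K t ∧ nup K t ≤ Nup)
    (hmup : ∀ K t, |t| ≤ l₀ → K₀ ≤ K → 0 ≤ mup K t ∧ mup K t ≤ Nup)
    -- the (2.5) side condition on the size function
    (R : ℕ → ℕ → ℕ) (hR : ∀ K s, s ≤ K → B14.IsRj F.L rr ((D.C ⟨K, F.m, g₀ K⟩).flow.g s) (R K s))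
    -- the side conditions of the geometric lemmas (row S1b): torus side, drop control, size function, window constant
    (hL4 : 4 ≤ F.L) (hdrop : ∀ m, B16SProfile.DropCtl sP m) (hn₁ : 13 ≤ C.n₁) (hR1 : ∀ K, K₀ ≤ K → ∀ t, 1 ≤ R K t)
    -- H3: the terms read as REALISED PENDING PEDIGREES of live components with root cells
    (ped : ℕ → ι → Pedigree α π) (cellP : ℕ → ι → π → Pt d × Finset (Pt d)) (liveC : ℕ → ι → Finset α)
    (Zd : ℕ → ι → α → Finset (Pt d)) (H : RealisedDomains F.L sP n K₀ R T ped cellP liveC Zd)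
    -- the flow side condition of the levels (row S6f): window exponents stepwise non-increasing; cells non-degenerate
    (hmono : ∀ t, sP (t + 1) ≤ sP t) (hn : 0 < n)
    {Fc Rf Fc' Rf' : ℕ → Finset (BSlot (Fin d → ℕ) PEv) → ℝ}
    (hprice : ∀ K t, |t| ≤ l₀ → K₀ ≤ K → ∀ τ ∈ badTerms (memOf ped liveC (cellOfA n F.L sP ped cellP)) jhalf T K,
      Fc K (bstrOf Prod.fst (memOf ped liveC (cellOfA n F.L sP ped cellP)) K τ) * Rf K (bstrOf Prod.fst (memOf ped liveC (cellOfA n F.L sP ped cellP)) K τ) ≤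
        ∏ q ∈ memOf ped liveC (cellOfA n F.L sP ped cellP) K τ,
          priceT Prod.fst C ((F.L : ℝ) ^ d) R (fun K => (D.C ⟨K, F.m, g₀ K⟩).flow.g) K q)
    (hprice' : ∀ K t, |t| ≤ l₀ → K₀ ≤ K → ∀ τ ∈ badTerms (memOf ped liveC (cellOfA n F.L sP ped cellP)) jhalf T K,
      Fc' K (bstrOf Prod.fst (memOf ped liveC (cellOfA n F.L sP ped cellP)) K τ) * Rf' K (bstrOf Prod.fst (memOf ped liveC (cellOfA n F.L sP ped cellP)) K τ) ≤
        ∏ q ∈ memOf ped liveC (cellOfA n F.L sP ped cellP) K τ,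
          priceT Prod.fst C ((F.L : ℝ) ^ d) R (fun K => (D.C ⟨K, F.m, g₀ K⟩).flow.g) K q)
    -- H3: the remaining `Regeneration` numerator readings, over the classes of the terms
    (up : ∀ K t, |t| ≤ l₀ → K₀ ≤ K → ∀ c ∈ badClasses Prod.fst (memOf ped liveC (cellOfA n F.L sP ped cellP)) jhalf T K,
      ∀ τ ∈ fibre (bstrOf Prod.fst (memOf ped liveC (cellOfA n F.L sP ped cellP))) T K c, A K t τ ≤ dead K t τ * Fc K c * nup K t)
    (dead_nonneg : ∀ K t, |t| ≤ l₀ → K₀ ≤ K → ∀ c ∈ badClasses Prod.fst (memOf ped liveC (cellOfA n F.L sP ped cellP)) jhalf T K,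
      ∀ τ ∈ fibre (bstrOf Prod.fst (memOf ped liveC (cellOfA n F.L sP ped cellP))) T K c, 0 ≤ dead K t τ)
    (resum : ∀ K t, |t| ≤ l₀ → K₀ ≤ K → ∀ c ∈ badClasses Prod.fst (memOf ped liveC (cellOfA n F.L sP ped cellP)) jhalf T K,
      ∑ τ ∈ fibre (bstrOf Prod.fst (memOf ped liveC (cellOfA n F.L sP ped cellP))) T K c, dead K t τ ≤ Rf K c)
    (F_nonneg : ∀ K t, |t| ≤ l₀ → K₀ ≤ K → ∀ c ∈ badClasses Prod.fst (memOf ped liveC (cellOfA n F.L sP ped cellP)) jhalf T K, 0 ≤ Fc K c)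
    (up' : ∀ K t, |t| ≤ l₀ → K₀ ≤ K → ∀ c ∈ badClasses Prod.fst (memOf ped liveC (cellOfA n F.L sP ped cellP)) jhalf T K,
      ∀ τ ∈ fibre (bstrOf Prod.fst (memOf ped liveC (cellOfA n F.L sP ped cellP))) T K c, A' K t τ ≤ dead' K t τ * Fc' K c * mup K t)
    (dead'_nonneg : ∀ K t, |t| ≤ l₀ → K₀ ≤ K → ∀ c ∈ badClasses Prod.fst (memOf ped liveC (cellOfA n F.L sP ped cellP)) jhalf T K,
      ∀ τ ∈ fibre (bstrOf Prod.fst (memOf ped liveC (cellOfA n F.L sP ped cellP))) T K c, 0 ≤ dead' K t τ)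
    (resum' : ∀ K t, |t| ≤ l₀ → K₀ ≤ K → ∀ c ∈ badClasses Prod.fst (memOf ped liveC (cellOfA n F.L sP ped cellP)) jhalf T K,
      ∑ τ ∈ fibre (bstrOf Prod.fst (memOf ped liveC (cellOfA n F.L sP ped cellP))) T K c, dead' K t τ ≤ Rf' K c)
    (F'_nonneg : ∀ K t, |t| ≤ l₀ → K₀ ≤ K → ∀ c ∈ badClasses Prod.fst (memOf ped liveC (cellOfA n F.L sP ped cellP)) jhalf T K,
      0 ≤ Fc' K c)
    -- the seam's other inputs
    (hSh : ShellWeightBound l₀ T A A' shA shB Wsh)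
    (hTB : ReindexedBudget l₀ vol T (fun K t τ => A K t τ - shA K t τ) (fun K t τ => A' K t τ - shB K t τ)
      (badOfClass (bstrOf Prod.fst (memOf ped liveC (cellOfA n F.L sP ped cellP))) T
        (fun K _ => badClasses Prod.fst (memOf ped liveC (cellOfA n F.L sP ped cellP)) jhalf T K)) Cc Rr CcRec RrRec ν u s₂ q₀ r s)
    (hr : Summable r) (hu : Summable u) (hs : Summable s) (hs₂ : Summable s₂) :
    ∃ K₁ K₂, K₀ ≤ K₁ ∧ HybridNE7 l₀ vol (fun K => T (K₁ + (K₂ + K))) (fun K => A (K₁ + (K₂ + K)))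
      (fun K => A' (K₁ + (K₂ + K)))
      (fun K => badOfClass (bstrOf Prod.fst (memOf ped liveC (cellOfA n F.L sP ped cellP))) T
        (fun K _ => badClasses Prod.fst (memOf ped liveC (cellOfA n F.L sP ped cellP)) jhalf T K) (K₁ + (K₂ + K)))
      (fun K => constOf l₀ B (max (em g) 0) n₁ c₀ Nup *
        recordsBudget (birthMass C) C.κ₁ ((n : ℝ) ^ d) ((F.L : ℝ) ^ d) (Real.log 2) jhalf (K₁ + (K₂ + K)))
      (fun K => shA (K₁ + (K₂ + K))) (fun K => shB (K₁ + (K₂ + K))) (fun K => Wsh (K₁ + (K₂ + K)))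
      (fun K => (r (K₁ + (K₂ + K)) + u (K₁ + (K₂ + K))) + (s (K₁ + (K₂ + K)) + s₂ (K₁ + (K₂ + K)))) :=
  hybridNE7_of_realisedReading_canon D h hμ d n hκ₁ hE₀ hb hlo hhi hγ hγβ S hp₀ hrr ht hir hsign hcor hγB hobs hbd hα
    hα' hc₀ hfloor hfloor' hsites hsites' hNup hnup hmup R hR hL4 hdrop hn₁ hR1 ped cellP liveC
    (cellOfA n F.L sP ped cellP) (realisedReading_of_domains (by omega) hn hmono hdrop H) hprice hprice' up dead_nonneg
    resum F_nonneg up' dead'_nonneg resum' F'_nonneg hSh hTB hr hu hs hs₂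

/-! ## §3 The same END with the prices in print's currency (v2) -/

/-- **THE SAME END WITH THE PRICES READ IN PRINT'S CURRENCY** (typer ACCEPT-A12I v1.3 residue (i)):
`HistoryAssemblyRealisePrice.hybridNE7_of_realisedReading_printed` (leaf-03, p210969: `Dominates C O`, realised
per-step costs `κ`, `κ′` below `costT`, H3's per-term price sentence in `pshapeTH` currency) with its binder
`H : RealisedReading …` SUPPLIED by `realisedReading_of_domains` — NO `cellOf`∕`cell_mem`∕`cell_inj` displayed; everything
else byte-identical. [folklore] -/
theorem hybridNE7_of_realisedDomains_printed (D : FiniteEpsData F G) {C : T4PrintedShapeBanking.Consts}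
    {O : PrintedO1s} (hD : Dominates C O)
    {rr : ℕ} {β₀ : ℝ} (h : ThresholdOK C F.L rr β₀) (hμ : 0 < C.μ) (d n : ℕ)
    (hκ₁ : (d : ℝ) * Real.log F.L + 2 * Real.log 2 ≤ C.κ₁) (hE₀ : Real.log (2 + birthMass C) ≤ C.E₀)
    -- the flow side (⇐ BetaPertH, displayed) and tuning
    {γ₀ γb b β' : ℝ} {pe : ℕ} (hb : 0 ≤ b) (hlo : FlowStep.BetaLowerH b γ₀ D.βfun)
    (hhi : FlowStep.BetaUpperH β' γ₀ D.βfun) (hγ : γb ≤ γ₀) (hγβ : γb ^ 2 * β' < 1)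
    (S : B14FlowStep.SmallnessFor γb β' β₀ F.L pe) (hp₀ : C.p₀ ≤ pe) (hrr : rr ≤ pe)
    {g : ℝ} {g₀ : ℕ → ℝ} (ht : D.Tuned γb g g₀)
    (hir : irThresholdTLE C F.L rr β₀ ≤ Real.log (g ^ 2)⁻¹)
    -- the (B) side
    (hsign : B16.SignConventions D.C) {γB : ℝ} {em ep : ℝ → ℝ} (hcor : B16.Cor3With D.C γB em ep) (hγB : γb ≤ γB)
    {obs : (K : ℕ) → GaugeField (F.P K) 0 G → ℝ} {B : ℝ}
    (hobs : ∀ K, Measurable (obs K)) (hbd : ∀ K U, |obs K U| ≤ B)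
    (hα : ∀ K t, |t| ≤ l₀ → K₀ ≤ K →
      ∫ U, Real.exp (t * obs K U) * D.dens K (g₀ K) 0 U ∂fieldMeasure (F.P K) 0 G ≤ ∑ τ ∈ T K, A K t τ)
    (hα' : ∀ K t, |t| ≤ l₀ → K₀ ≤ K →
      ∫ U, Real.exp (t * obs (K + 1) U) * D.dens (K + 1) (g₀ (K + 1)) 0 U ∂fieldMeasure (F.P (K + 1)) 0 G ≤
        ∑ τ ∈ T K, A' K t τ)
    {c₀ n₁ : ℝ} (hc₀ : 0 < c₀) (hfloor : ∀ K, K₀ ≤ K → c₀ ≤ smallFieldMass D K (g₀ K))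
    (hfloor' : ∀ K, K₀ ≤ K → c₀ ≤ smallFieldMass D (K + 1) (g₀ (K + 1)))
    (hsites : ∀ K, K₀ ≤ K → ((D.C ⟨K, F.m, g₀ K⟩).numSites K : ℝ) ≤ n₁)
    (hsites' : ∀ K, K₀ ≤ K → ((D.C ⟨K + 1, F.m, g₀ (K + 1)⟩).numSites (K + 1) : ℝ) ≤ n₁)
    (hNup : 0 ≤ Nup) (hnup : ∀ K t, |t| ≤ l₀ → K₀ ≤ K → 0 ≤ nup K t ∧ nup K t ≤ Nup)
    (hmup : ∀ K t, |t| ≤ l₀ → K₀ ≤ K → 0 ≤ mup K t ∧ mup K t ≤ Nup)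
    -- the (2.5) side condition on the size function
    (R : ℕ → ℕ → ℕ) (hR : ∀ K s, s ≤ K → B14.IsRj F.L rr ((D.C ⟨K, F.m, g₀ K⟩).flow.g s) (R K s))
    -- H3: the terms read as REALISED PENDING PEDIGREES WITH DOMAINS (root cells := `cellOfA`)
    -- the side conditions of the geometric lemmas (row S1b): torus side, drop control, window constant, size function
    (hL4 : 4 ≤ F.L) (hdrop : ∀ m, B16SProfile.DropCtl sP m) (hn₁ : 13 ≤ C.n₁) (hR1 : ∀ K, K₀ ≤ K → ∀ t, 1 ≤ R K t)
    (ped : ℕ → ι → Pedigree α π) (cellP : ℕ → ι → π → Pt d × Finset (Pt d)) (liveC : ℕ → ι → Finset α)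
    (Zd : ℕ → ι → α → Finset (Pt d)) (H : RealisedDomains F.L sP n K₀ R T ped cellP liveC Zd)
    -- the flow side condition of the levels (row S6f): window exponents stepwise non-increasing; cells non-degenerate
    (hmono : ∀ t, sP (t + 1) ≤ sP t) (hn : 0 < n)
    -- H3: realised per-step costs of the live members, read below the model's booked cost (reading (ID-a))
    (κ κ' : ℕ → (Fin d → ℕ) × Gen (Lab α π) → Gen (Lab α π) → ℕ → ℝ)
    (hκ : ∀ K, K₀ ≤ K → ∀ τ ∈ badTerms (memOf ped liveC (cellOfA n F.L sP ped cellP)) jhalf T K, ∀ q ∈ memOf ped liveC (cellOfA n F.L sP ped cellP) K τ,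
      ∀ m ∈ life (padW (dictWT Prod.fst (R K) C.n₁) 0) q.2,
        κ K q q.2 m ≤ costT Prod.fst C K (R K) q.2 m)
    (hκ' : ∀ K, K₀ ≤ K → ∀ τ ∈ badTerms (memOf ped liveC (cellOfA n F.L sP ped cellP)) jhalf T K, ∀ q ∈ memOf ped liveC (cellOfA n F.L sP ped cellP) K τ,
      ∀ m ∈ life (padW (dictWT Prod.fst (R K) C.n₁) 0) q.2,
        κ' K q q.2 m ≤ costT Prod.fst C K (R K) q.2 m)
    -- H3: the per-term price sentence in PRINT's currency, both runs
    {Fc Rf Fc' Rf' : ℕ → Finset (BSlot (Fin d → ℕ) PEv) → ℝ}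
    (hP : ∀ K t, |t| ≤ l₀ → K₀ ≤ K → ∀ τ ∈ badTerms (memOf ped liveC (cellOfA n F.L sP ped cellP)) jhalf T K,
      Fc K (HistorySocketTH.bstrOf Prod.fst (memOf ped liveC (cellOfA n F.L sP ped cellP)) K τ) *
          Rf K (HistorySocketTH.bstrOf Prod.fst (memOf ped liveC (cellOfA n F.L sP ped cellP)) K τ) ≤
        ∏ q ∈ memOf ped liveC (cellOfA n F.L sP ped cellP) K τ,
          pshapeTH Prod.fst O C 1 ((F.L : ℝ) ^ d) (R K) (D.C ⟨K, F.m, g₀ K⟩).flow.g 0 (κ K q) q.2)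
    (hP' : ∀ K t, |t| ≤ l₀ → K₀ ≤ K → ∀ τ ∈ badTerms (memOf ped liveC (cellOfA n F.L sP ped cellP)) jhalf T K,
      Fc' K (HistorySocketTH.bstrOf Prod.fst (memOf ped liveC (cellOfA n F.L sP ped cellP)) K τ) *
          Rf' K (HistorySocketTH.bstrOf Prod.fst (memOf ped liveC (cellOfA n F.L sP ped cellP)) K τ) ≤
        ∏ q ∈ memOf ped liveC (cellOfA n F.L sP ped cellP) K τ,
          pshapeTH Prod.fst O C 1 ((F.L : ℝ) ^ d) (R K) (D.C ⟨K, F.m, g₀ K⟩).flow.g 0 (κ' K q) q.2)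
    -- H3: the remaining `Regeneration` numerator readings, over the classes of the terms
    (up : ∀ K t, |t| ≤ l₀ → K₀ ≤ K → ∀ c ∈ badClasses Prod.fst (memOf ped liveC (cellOfA n F.L sP ped cellP)) jhalf T K,
      ∀ τ ∈ fibre (HistorySocketTH.bstrOf Prod.fst (memOf ped liveC (cellOfA n F.L sP ped cellP))) T K c,
        A K t τ ≤ dead K t τ * Fc K c * nup K t)
    (dead_nonneg : ∀ K t, |t| ≤ l₀ → K₀ ≤ K → ∀ c ∈ badClasses Prod.fst (memOf ped liveC (cellOfA n F.L sP ped cellP)) jhalf T K,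
      ∀ τ ∈ fibre (HistorySocketTH.bstrOf Prod.fst (memOf ped liveC (cellOfA n F.L sP ped cellP))) T K c, 0 ≤ dead K t τ)
    (resum : ∀ K t, |t| ≤ l₀ → K₀ ≤ K → ∀ c ∈ badClasses Prod.fst (memOf ped liveC (cellOfA n F.L sP ped cellP)) jhalf T K,
      ∑ τ ∈ fibre (HistorySocketTH.bstrOf Prod.fst (memOf ped liveC (cellOfA n F.L sP ped cellP))) T K c, dead K t τ ≤ Rf K c)
    (F_nonneg : ∀ K t, |t| ≤ l₀ → K₀ ≤ K → ∀ c ∈ badClasses Prod.fst (memOf ped liveC (cellOfA n F.L sP ped cellP)) jhalf T K, 0 ≤ Fc K c)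
    (up' : ∀ K t, |t| ≤ l₀ → K₀ ≤ K → ∀ c ∈ badClasses Prod.fst (memOf ped liveC (cellOfA n F.L sP ped cellP)) jhalf T K,
      ∀ τ ∈ fibre (HistorySocketTH.bstrOf Prod.fst (memOf ped liveC (cellOfA n F.L sP ped cellP))) T K c,
        A' K t τ ≤ dead' K t τ * Fc' K c * mup K t)
    (dead'_nonneg : ∀ K t, |t| ≤ l₀ → K₀ ≤ K → ∀ c ∈ badClasses Prod.fst (memOf ped liveC (cellOfA n F.L sP ped cellP)) jhalf T K,
      ∀ τ ∈ fibre (HistorySocketTH.bstrOf Prod.fst (memOf ped liveC (cellOfA n F.L sP ped cellP))) T K c, 0 ≤ dead' K t τ)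
    (resum' : ∀ K t, |t| ≤ l₀ → K₀ ≤ K → ∀ c ∈ badClasses Prod.fst (memOf ped liveC (cellOfA n F.L sP ped cellP)) jhalf T K,
      ∑ τ ∈ fibre (HistorySocketTH.bstrOf Prod.fst (memOf ped liveC (cellOfA n F.L sP ped cellP))) T K c, dead' K t τ ≤ Rf' K c)
    (F'_nonneg : ∀ K t, |t| ≤ l₀ → K₀ ≤ K → ∀ c ∈ badClasses Prod.fst (memOf ped liveC (cellOfA n F.L sP ped cellP)) jhalf T K,
      0 ≤ Fc' K c)
    -- the seam's other inputs
    (hSh : ShellWeightBound l₀ T A A' shA shB Wsh)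
    (hTB : ReindexedBudget l₀ vol T (fun K t τ => A K t τ - shA K t τ) (fun K t τ => A' K t τ - shB K t τ)
      (badOfClass (HistorySocketTH.bstrOf Prod.fst (memOf ped liveC (cellOfA n F.L sP ped cellP))) T
        (fun K _ => badClasses Prod.fst (memOf ped liveC (cellOfA n F.L sP ped cellP)) jhalf T K)) Cc Rr CcRec RrRec ν u s₂ q₀ r s)
    (hr : Summable r) (hu : Summable u) (hs : Summable s) (hs₂ : Summable s₂) :
    ∃ K₁ K₂, K₀ ≤ K₁ ∧ HybridNE7 l₀ vol (fun K => T (K₁ + (K₂ + K))) (fun K => A (K₁ + (K₂ + K)))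
      (fun K => A' (K₁ + (K₂ + K)))
      (fun K => badOfClass (HistorySocketTH.bstrOf Prod.fst (memOf ped liveC (cellOfA n F.L sP ped cellP))) T
        (fun K _ => badClasses Prod.fst (memOf ped liveC (cellOfA n F.L sP ped cellP)) jhalf T K) (K₁ + (K₂ + K)))
      (fun K => constOf l₀ B (max (em g) 0) n₁ c₀ Nup *
        recordsBudget (birthMass C) C.κ₁ ((n : ℝ) ^ d) ((F.L : ℝ) ^ d) (Real.log 2) jhalf (K₁ + (K₂ + K)))
      (fun K => shA (K₁ + (K₂ + K))) (fun K => shB (K₁ + (K₂ + K))) (fun K => Wsh (K₁ + (K₂ + K)))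
      (fun K => (r (K₁ + (K₂ + K)) + u (K₁ + (K₂ + K))) + (s (K₁ + (K₂ + K)) + s₂ (K₁ + (K₂ + K)))) :=
  hybridNE7_of_realisedReading_printed D hD h hμ d n hκ₁ hE₀ hb hlo hhi hγ hγβ S hp₀ hrr ht hir hsign hcor hγB hobs hbd
    hα hα' hc₀ hfloor hfloor' hsites hsites' hNup hnup hmup R hR hL4 hdrop hn₁ hR1 ped cellP liveC
    (cellOfA n F.L sP ped cellP) (realisedReading_of_domains (by omega) hn hmono hdrop H) κ κ' hκ hκ' hP hP' up
    dead_nonneg resum F_nonneg up' dead'_nonneg resum' F'_nonneg hSh hTB hr hu hs hs₂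

end End

end

end Summit.QuantumFields.BalabanUV.T4Continuum.HistoryRealiseCellsEnd
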